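import Summits.QuantumFields.YangMills.Theorems.BalabanUVNodesN24N09AxDoorNumericRows7PaidAtGaussPinThm1CCMWZBAx
import Summits.QuantumFields.YangMills.Theorems.BalabanUVNodesN13Cor3AsymJunctionThm2KeyedAtBgRegFullBudgetAtRecord13CoPH

/-!
# NODE N24 (B2) — N09's Ax DOOR AT THE GAUSS PIN: THE (8)-MEMBERSHIP ROW `hreg8` PAID (it is DEFINITIONAL for the tree's background of record `Uk`), SIX ANALYTIC ROWS LEFT
# (helper beside ✓p816166∕✓p816593 `…N24N09AxDoorNumericRows7PaidAtGaussPinThm1CCMWZBAx` (X)∕(X′); g23's Ax door v2 ✓p812325 §5; N09 content typed from the K1ᴬ lane — yields to any dag-n09 seat on sight)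

TRACK A (YM-PLAN §2d, node N24 of 28 = binder B2, COMPOSITE), seat `pub-ymgap-dag-n24-c` (gen 26; the -a hand on K1ᴬ stmt-QuantumFields-27239 LINE 2′, v11.2 2c0c0eed585a0c47;
`--supports stmt-QuantumFields-27239 --as helper`, count-neutral).

WHAT THIS FILE PROVES (bookkeeping over NODE 00's definitions; no estimate of Bałaban's):
* §1 ★ `hreg8_of_εreg_eq_εbg`: the (8)-membership row `hreg8 : ∀ P k ≤ P.K, ∀ V ∈ domAlt_k, Uk F N P.K k θN.εbg V ∈ bgReg F N P.K k θN.ν.εreg` of the Ax door v2 holds OUTRIGHT at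
  every Stage-13 tuple with `θN.ν.εreg = θN.εbg > 0` — in particular at the engine's Gauss pin, where both radii are the letter `a₀` (`rfl`, as in (X)) — because for EVERY `V` the
  background of record lies in its own regularity class: dag-n13's ✓`N13Cor3AsymJunctionThm2KeyedAtBgRegFullBudgetAtRecord13CoPH.Uk_mem_bgReg_all` (CITED, not restated: on the solvable
  set `Uk` is a CHOICE of a minimiser WITHIN `bgReg … ε`, `Node00.Uk_mem_bgReg`; off it the junk default `1` has trivial plaquette variables, `dist1 1 = 0 < ε·η²`).  In print the row is
  [B11] Thm 1's clause (8) for the minimiser; in the tree that clause is PART OF THE DEFINITION of `Uk` (`IsBackground … (bgReg … ε) …`), so the row carries no content beyond `h11`'s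
  solvability — it was displayed, not owed.  The `domAlt` guard is not even used.
* §2 ★★ `N24_h09T_recordAx_at_gaussPinH_theta13OfThm1CCMWZBAx_of_analyticRows6`: (X)'s door-at-the-pin with `hreg8` DERIVED — N09's Theorem-3 member at the pin from SIX analytic located rows
  `haxbg` (hierarchical axiality of the background w.r.t. `contourOfRecord` — a CONVENTION row: `Uk` is a bare choice, a hierarchically axial selection makes it definitional, def-R∕def-T's
  re-point, see ✓p812325's header), `hχregpt` (the re-centred cut-off's support property), `hint` (integrability of the β-input), `h11` ∕ `hres` ∕ `huniq` ([B11] Thm 1 at `εbg`), the numerics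
  paid by (X) from `0 < a₀ ≤ 1∕(109824·L²)`, `ε₀ = a₀`, `0 < ε₂₉`.  Same abstract-`θN`-pinned-by-`hθ` idiom as (X), so an engine edition displaying six rows at `θN = Θ →` consumes it verbatim.
RESIDUAL N09 DEBT AT THE WITNESS after this file: SIX analytic rows + the Lemma-4 member `h09` (was seven + member).  The engine of record (W) ✓p816238 and the (ℓ1) junction ✓p830999 still DISPLAY
seven rows (`h09R`); dropping `hreg8` there is an edition on the desk's word.
HONEST FRAMING.  Bookkeeping only (a definitional receipt, cited, + one composition); nothing of Bałaban asserted, ported or discharged; N09 NOT discharged (its six analytic rows + member are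
[B11] Thm 1 ∕ [B12] §1–§2 ∕ (0.13)-regularity content, displayed); no registered stub closed (v11.2 0∕6); K0ᴬ∕K1ᴬ∕K3ᴬ OPEN; counts UNMOVED (8∕28 · K 1∕4); finite 𝕋⁴ at fixed ε; NOT
continuum ∕ OS ∕ Clay; the Yang–Mills mass gap is NOT proved.  No `sorry`, `def`, `instance`, `notation`; standard axioms.
References (bookkeeping): [Balaban1987RG1] (0.21) p.256, (1.1)–(1.2) p.260, Thm 3 p.264; [Balaban1985Variational] Thm 1 (6), (8)–(10) p.279; [Balaban1985Averaging] (9) p.18.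
-/

noncomputable section

open scoped Matrix.Norms.L2Operator BigOperators
open MeasureTheory

namespace Summit.QuantumFields.YangMills.BalabanUVNodes.N24N09AxDoorReg8PaidAtGaussPinThm1CCMWZBAx

open Literature.MathematicalPhysics.QuantumFieldTheory.Balaban1983to89
open Literature.MathematicalPhysics.QuantumFieldTheory.Balaban1983to89.T4Continuum
open Literature.MathematicalPhysics.QuantumFieldTheory.Balaban1983to89.DagBinding (WorldP leavesP)
open Literature.MathematicalPhysics.QuantumFieldTheory.Balaban1983to89.Node00
open Summit.QuantumFields.YangMills.BalabanUVNodes.N13Cor3AsymJunctionThm2KeyedAtBgRegFullBudgetAtRecord13CoPH (Uk_mem_bgReg_all)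
open Summit.QuantumFields.YangMills.Theorems.BalabanUVNodesN11GaussianCertificateDefsChi (gaussPinH)
open Summit.QuantumFields.YangMills.BalabanUVNodes.N24N09AxDoorNumericRows7PaidAtGaussPinThm1CCMWZBAx (N24_h09T_recordAx_at_gaussPinH_theta13OfThm1CCMWZBAx_of_analyticRows7)

/-! ## §1  The (8)-membership row is definitional for the background of record -/

section Generic

variable {F : T4Family} {N : ℕ} [NeZero N]

/-- ★ **THE (8)-MEMBERSHIP ROW `hreg8` OF N09's Ax DOOR v2 HOLDS OUTRIGHT at every Stage-13 tuple whose background-regularity radius `ν.εreg` IS the background radius `εbg > 0`** (the door also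
displays `hle : εreg ≤ εbg`; at the engine's Gauss pin both are the letter `a₀`), by dag-n13's ✓`Uk_mem_bgReg_all` (every `V`; the `domAlt` guard is not used). [cite: Balaban1987RG1, (1.2) p.260; Balaban1985Variational, Thm 1 (8) p.279 (bookkeeping)] -/
theorem hreg8_of_εreg_eq_εbg (θN : Stage13HParams F N) (hreg : θN.ν.εreg = θN.εbg) (hε : 0 < θN.εbg) :
    ∀ (P : B12.RunParams) (k : ℕ), k ≤ P.K → ∀ V ∈ domAltOfRecord F N θN.ν P.K k, Uk F N P.K k θN.εbg V ∈ bgReg F N P.K k θN.ν.εreg := by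
  intro P k _ V _
  rw [hreg]
  exact Uk_mem_bgReg_all F N P.K k hε V

end Generic

/-! ## §2  N09's Ax door at the Gauss pin from SIX analytic rows -/

variable {F : T4Family}

/-- ★★ **N09's Ax DOOR AT THE GAUSS PIN OF THE WINDOWED COLLARED z-WITNESS FROM SIX ANALYTIC ROWS** — (X) ✓p816166 `…_of_analyticRows7` with its row `hreg8` DERIVED by §1 (at the pin
`θN.εbg = θN.ν.εreg = a₀`, `rfl`).  Displayed: `haxbg` (convention row, see header), `hχregpt`, `hint`, `h11`, `hres`, `huniq`; the engine's letters `0 < a₀ ≤ 1∕(109824·L²)`, `ε₀ = a₀`, `0 < ε₂₉`.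
CONDITIONAL on those six rows ([B11] Thm 1 ∕ [B12] §§1–2 ∕ (0.13)-regularity content, displayed, discharged by nobody); N09 NOT discharged.
[cite: Balaban1987RG1, Thm 3 p.264, (1.20)–(1.22) p.264, (0.21) p.256, (1.1)–(1.2) p.260, (2.9) p.266; Balaban1985Variational, Thm 1 (6), (8)–(10) p.279; Balaban1988Convergent, (2.4) p.255, (3.16)–(3.20) pp.268–269 (bookkeeping)] -/
theorem N24_h09T_recordAx_at_gaussPinH_theta13OfThm1CCMWZBAx_of_analyticRows6 {j : ℕ} {γ ε₀ ε₂₉ B₃ B₉ a₀ a₁' : ℝ} {Efl logz : B12.RunParams → ℕ → ℝ}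
    {Zr : (p : B12.RunParams) → TkResidualW F 2 (FluctV 2) p.K} {χ : ChiSlot F 2} {θN : Stage13HParams F 2} (h : θN.Provisos₁₃SepCoPHAx F 2)
    (hθ : θN = gaussPinH (Stage13HParams.ofHistoryBlind F 2 ⟨theta13OfThm1CCMWZBAx F 2 j γ a₀ ε₀ ε₂₉ B₃ B₉ a₀ a₁' Efl logz, Zr⟩) χ)
    (ha₀ : 0 < a₀) (ha₀ρ : a₀ ≤ 1 / (109824 * (F.L : ℝ) ^ 2)) (hε₀def : ε₀ = a₀) (hε' : 0 < ε₂₉)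
    (haxbg : ∀ (P : B12.RunParams) (k : ℕ), k ≤ P.K → ∀ V ∈ domAltOfRecord F 2 θN.ν P.K k, ∀ j < k,
      AxialGauge (contourOfRecord F 2 P.K j) (Averaging.iter (avOfRecord F 2 P.K) j (Uk F 2 P.K k θN.εbg V)))
    (hχregpt : ∀ (P : B12.RunParams) (i : ℕ), i + 1 < P.K → ∀ U : GaugeField (F.P P.K) (i + 1) (SU 2),
      (avOfRecord F 2 P.K (i + 1)).avg U ∈ domAltOfRecord F 2 θN.ν P.K (i + 2) →
        U ∉ regSetOfRecord F 2 P.K i (betaInputOfRecord F 2 (TβOfRecord₁₃ F 2) (chiβOfRecord₁₃Ax F 2 θN.toStage13Params) P.K (gOfRecord₁₃Ax F 2 θN.toStage13Params P) i) ∩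
            domAltOfRecord F 2 θN.ν P.K (i + 1) →
          chiβOfRecord₁₃Ax F 2 θN.toStage13Params P.K (gOfRecord₁₃Ax F 2 θN.toStage13Params P) (i + 1) U = 0)
    (hint : ∀ (P : B12.RunParams), ∀ j < P.K, Integrable (betaInputOfRecord F 2 (TβOfRecord₁₃ F 2) (chiβOfRecord₁₃Ax F 2 θN.toStage13Params) P.K
      (gOfRecord₁₃Ax F 2 θN.toStage13Params P) j) (fieldMeasure (F.P P.K) j (SU 2)))
    (h11 : ∀ (P : B12.RunParams) (k : ℕ), k ≤ P.K → ∀ V ∈ domAltOfRecord F 2 θN.ν P.K k, UkExists F 2 P.K k θN.εbg V ∧ UniqueUkOrbit F 2 P.K k θN.εbg V)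
    (hres : ∀ (P : B12.RunParams) (k : ℕ), k ≤ P.K → HRestrict F 2 θN.εbg P.K k (domAltOfRecord F 2 θN.ν P.K k))
    (huniq : ∀ (P : B12.RunParams) (k : ℕ), k ≤ P.K → ∀ V ∈ domAltOfRecord F 2 θN.ν P.K k, ∀ j < k,
      UniqueUkOrbit F 2 P.K (j + 1) θN.εbg (Averaging.iter (avOfRecord F 2 P.K) (j + 1) (Uk F 2 P.K k θN.εbg V))) :
    ∃ γ₉ : ℝ, 0 < γ₉ ∧ ∀ w : WorldP, w.C = (datumOfRecord₁₃SepCoPHAx F 2 θN h).C → w.γ ≤ γ₉ →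
      ∀ P : B12.RunParams, (leavesP w P).smallCouplings → (leavesP w P).smallFieldInductive := by
  -- the pin's two radius faces (`rfl`, as in (X)): `θN.εbg = a₀`, `θN.ν.εreg = a₀`
  have fbg : θN.εbg = a₀ := by subst hθ; rfl
  have freg : θN.ν.εreg = a₀ := by subst hθ; rfl
  exact N24_h09T_recordAx_at_gaussPinH_theta13OfThm1CCMWZBAx_of_analyticRows7 h hθ ha₀ ha₀ρ hε₀def hε'
    (hreg8_of_εreg_eq_εbg θN (freg.trans fbg.symm) (fbg ▸ ha₀)) haxbg hχregpt hint h11 hres huniq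

end Summit.QuantumFields.YangMills.BalabanUVNodes.N24N09AxDoorReg8PaidAtGaussPinThm1CCMWZBAx

end
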